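import Summits.QuantumFields.YangMills.Theorems.LuscherReductionTwistedTraceScalingBOStiffCentralFloor
import Summits.QuantumFields.YangMills.Theorems.LuscherReductionTwistedTraceScalingBODualProfile
import HarnessLib

/-!
# (B-ST) central-fibre data: on the support, the GAUGE GAUSSIAN CANCELS in `cΘ·cW` (cdisprove UPDATE 23b (1)) — inputs of hup (A) and of hν/hν' (B4)
# (lane A of S-BASE, crux `TwistedTraceScaling` stmt-QuantumFields-20203, C4-CORE, the (B-ST) pen; HANDOFF-g21 'REMAINING ANALYTIC ATOMS')

At the central tube point `U = orthoTube 1 x` of the record fat tube, `χ(U) = e^{−gaugeCoordSq(U)·β²}` and `gaugeCoordSq(U) = ‖P_Γ x̂‖²` (`x̂ = linkEmbed x`), while the profile is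
`cΘ = e^{−‖P_Γ x̂‖²β²}·e^{−q(x̂)}` on its support; so the weight `cW = N/χ` (N = gaugeAvg χ) undoes the gauge Gaussian exactly:
★ `mem_capBalancedSet_of_mem_cS` — `x ∈ cS ⇒ x ∈ Bal`; ★★ `cΘ_mul_cW_eq` — `cΘ x · cW x = e^{−q_β(x̂)} · N(orthoTube 1 x)` for `x ∈ cS` with `orthoTube 1 x` in the fat tube
(✓ `frozenProfile_mul_softWeight_recordChi`); ★★ `cΘ_sq_mul_cW_eq` — `cΘ² · cW = N(orthoTube 1 x) · e^{−‖P_Γ x̂‖²/β^{-2}} · e^{−2 q_β(x̂)}` — the right side of hup and the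
density `D` of hν/hν' carry NO inverse gauge Gaussian.
HONEST FRAMING: bookkeeping for a stub of a child of the CONDITIONAL route R2b1; (B-ST) OPEN; C4-CORE OPEN; not infinite volume, not a gap, not Clay.
-/

set_option autoImplicit false

noncomputable section

open MeasureTheory

namespace Summit.QuantumFields.YangMills.Theorems.FemtoTransferGap.TwoLattice.ConstTube

open Literature.MathematicalPhysics.QuantumFieldTheory Literature.MathematicalPhysics.QuantumLattice TwoLattice.Avg TwoLattice.Stiff TwoLattice.GnChart TwoLattice.Cov

variable {L : ℕ} [NeZero L]

/-- ★ A point of the profile support is balanced-capped. [folklore] -/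
theorem mem_capBalancedSet_of_mem_cS (β : ℝ) {x : Edge 3 L → Fin 3 → ℝ} (hx : x ∈ cS L β) : x ∈ capBalancedSet L := by
  have hne : cΘ L β x ≠ 0 := hx
  unfold cΘ cΩ at hne
  by_contra hcap
  apply hne
  rw [Set.indicator_of_notMem (fun h => hcap ((linkEmbed_mem_capLink_iff (L := L) x).1 h)), zero_mul]

/-- ★★ **The gauge Gaussian cancels**: `cΘ x · cW x = e^{−q_β(x̂)} · gaugeAvg χ (orthoTube 1 x)` for `x ∈ cS β` with `orthoTube 1 x` in the record fat tube. [cite: Luscher1983, §3] -/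
theorem cΘ_mul_cW_eq (s M β : ℝ) {x : Edge 3 L → Fin 3 → ℝ} (hx : x ∈ cS L β)
    (hF : orthoTube L 1 x ∈ fatTubeRho L (fun β => 43 * powScale s β) (fun b => M * (43 * powScale s b)) β) :
    cΘ L β x * cW L s M β x = Real.exp (-(stiffGaussExp L (β / 2) β (linkEmbed L x))) * gaugeAvg (recordChi L s 43 M β) (orthoTube L 1 x) := by
  have hcap := mem_capBalancedSet_of_mem_cS (L := L) β hx
  obtain ⟨-, hr⟩ := cΘ_eq_on_cS (L := L) β hx
  have hball : linkEmbed L x ∈ Metric.closedBall (0 : LinkSpace L) (min (1 / 40) (powScale (1 / 2) β * btLog β)) := by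
    simpa [Metric.mem_closedBall, dist_zero_right] using hr
  have h := frozenProfile_mul_softWeight_recordChi (L := L) s 43 M β (fun β' => stiffGaussExp L (β' / 2) β') (fun β' => min (1 / 40) (powScale (1 / 2) β' * btLog β')) 1 hcap hF
  have hind : {y : LinkSpace L | linkCurry y ∈ capBalancedSet L}.indicator (fun _ => (1 : ℝ)) (linkEmbed L x) = 1 :=
    Set.indicator_of_mem ((linkEmbed_mem_capLink_iff (L := L) x).2 hcap) _
  unfold cΘ cΩ cW
  rw [hind, one_mul, h, Set.indicator_of_mem hball, mul_one]

/-- ★★ **The density of the fibre block**: `cΘ² · cW = N(orthoTube 1 x) · e^{−‖P_Γ x̂‖²/β^{-2}} · e^{−2q_β(x̂)}` for `x ∈ cS β` with `orthoTube 1 x` in the fat tube. [cite: Luscher1983, §3] -/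
theorem cΘ_sq_mul_cW_eq (s M β : ℝ) {x : Edge 3 L → Fin 3 → ℝ} (hx : x ∈ cS L β)
    (hF : orthoTube L 1 x ∈ fatTubeRho L (fun β => 43 * powScale s β) (fun b => M * (43 * powScale s b)) β) :
    cΘ L β x ^ 2 * cW L s M β x =
      gaugeAvg (recordChi L s 43 M β) (orthoTube L 1 x) * (Real.exp (-(‖(gaugeModes L).starProjection (linkEmbed L x)‖ ^ 2 / powScale 1 β ^ 2)) *
        Real.exp (-(2 * stiffGaussExp L (β / 2) β (linkEmbed L x)))) := by
  obtain ⟨e, -⟩ := cΘ_eq_on_cS (L := L) β hx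
  have h := cΘ_mul_cW_eq (L := L) s M β hx hF
  calc cΘ L β x ^ 2 * cW L s M β x = cΘ L β x * (cΘ L β x * cW L s M β x) := by ring
    _ = cΘ L β x * (Real.exp (-(stiffGaussExp L (β / 2) β (linkEmbed L x))) * gaugeAvg (recordChi L s 43 M β) (orthoTube L 1 x)) := by rw [h]
    _ = _ := by
      rw [e]
      have e2 : Real.exp (-(2 * stiffGaussExp L (β / 2) β (linkEmbed L x))) =
          Real.exp (-(stiffGaussExp L (β / 2) β (linkEmbed L x))) * Real.exp (-(stiffGaussExp L (β / 2) β (linkEmbed L x))) := by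
        rw [← Real.exp_add]; ring_nf
      rw [e2]; ring

end Summit.QuantumFields.YangMills.Theorems.FemtoTransferGap.TwoLattice.ConstTube

end
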